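import Mathlib

/-!
# Stub `cauchyKernel_differentiableOn` (plan T2, component T2i) for crux
`WeilComb.CombShapePositivity`
(item stmt-RiemannHypothesis-11229, route route-RiemannHypothesis-WeilComb, line `Sketch`,
stub-plan `Cruxes/CombShapePositivity/STUB-PLAN-stub_fejer.md`, tier T2 "dilation detection")

**Holomorphy of the segment Cauchy kernel.** For a continuous weight `f : ℝ → ℂ` and `w : ℂ`,
the kernel

  `K_f(w, s) = ∫_{-2}^{2} f(t) e^{wt - s} / (s - wt) dt`

is holomorphic on the complement `U_w = {s | ∀ t ∈ [-2,2], s ≠ wt}` of the closed segment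
`w·[-2,2]` (for `w = 0` this is `{s ≠ 0}`). In tier T2 of the plan this kernel is the Laplace
transform (in the dilation parameter `ε`) of one zero's contribution to `Re W(φ_ε ⋆ φ̃_ε)`;
the present lemma is the holomorphy input for the Landau/jump contradiction.

Proof: `U_w` is open (complement of the continuous image of the compact `Icc (-2) 2`).  Fix
`s₀ ∈ U_w` and a closed ball `closedBall s₀ r ⊆ U_w`.  The integrand
`G(s,t) = f t e^{wt-s}/(s-wt)` has `s`-derivative `G'(s,t) = -f t e^{wt-s} (s - wt + 1)/(s - wt)²`,
jointly continuous on the compact `closedBall s₀ r × [-2,2]`, hence bounded there by a constant;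
differentiation under the integral sign
(`intervalIntegral.hasDerivAt_integral_of_dominated_loc_of_deriv_le`) gives `HasDerivAt` at `s₀`
(`hasDerivAt_cauchyKernel`), whence `DifferentiableOn` and `ContinuousOn`.
-/

noncomputable section

-- the sub-problem path RiemannHypothesis/RiemannHypothesis duplicates a namespace (D-0017)
set_option linter.dupNamespace false

open scoped Topology Interval
open Complex MeasureTheory Set Filter

namespace Summit.RiemannHypothesis.RiemannHypothesis.Theorems.WeilCombBohrFejer

/-- The segment-free set `U_w = {s | ∀ t ∈ [-2,2], s ≠ wt}` is open: it is the complement of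
the image of the compact interval `[-2,2]` under the continuous map `t ↦ wt`. [folklore] -/
theorem isOpen_cauchyKernelDomain (w : ℂ) :
    IsOpen {s : ℂ | ∀ t : ℝ, t ∈ Set.Icc (-2 : ℝ) 2 → s ≠ w * t} := by
  have h : IsClosed ((fun t : ℝ => w * (t : ℂ)) '' Set.Icc (-2 : ℝ) 2) :=
    (isCompact_Icc.image (by fun_prop)).isClosed
  convert h.isOpen_compl using 1
  ext s
  simp only [Set.mem_setOf_eq, Set.mem_compl_iff, Set.mem_image, not_exists, not_and]
  exact forall₂_congr fun t _ => ⟨fun h1 h2 => h1 h2.symm, fun h1 h2 => h1 h2.symm⟩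

/-- **Differentiation under the integral sign for the segment Cauchy kernel.** For continuous
`f` and `s₀ ∈ U_w`,
`d/ds ∫_{-2}^{2} f t e^{wt-s}/(s-wt) dt |_{s₀} = ∫_{-2}^{2} -f t e^{wt-s₀} (s₀-wt+1)/(s₀-wt)² dt`.
[folklore] -/
theorem hasDerivAt_cauchyKernel {f : ℝ → ℂ} (hf : Continuous f) (w : ℂ) {s₀ : ℂ}
    (hs₀ : ∀ t : ℝ, t ∈ Set.Icc (-2 : ℝ) 2 → s₀ ≠ w * t) :
    HasDerivAt (fun s : ℂ => ∫ t in (-2 : ℝ)..2, f t * Complex.exp (w * t - s) / (s - w * t))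
      (∫ t in (-2 : ℝ)..2,
        -(f t * Complex.exp (w * t - s₀) * (s₀ - w * t + 1)) / (s₀ - w * t) ^ 2) s₀ := by
  -- the domain is open: choose a closed ball around `s₀` inside it
  have hUo := isOpen_cauchyKernelDomain w
  obtain ⟨ε, hε, hεU⟩ := Metric.isOpen_iff.mp hUo s₀ hs₀
  set r : ℝ := ε / 2 with hr
  have hr0 : 0 < r := half_pos hε
  have hcb : Metric.closedBall s₀ r ⊆ {s : ℂ | ∀ t : ℝ, t ∈ Set.Icc (-2 : ℝ) 2 → s ≠ w * t} :=
    (Metric.closedBall_subset_ball (half_lt_self hε)).trans hεU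
  have hball : Metric.ball s₀ r ⊆ {s : ℂ | ∀ t : ℝ, t ∈ Set.Icc (-2 : ℝ) 2 → s ≠ w * t} :=
    Metric.ball_subset_closedBall.trans hcb
  -- nonvanishing of the denominators on the domain
  have hne : ∀ s ∈ {s : ℂ | ∀ t : ℝ, t ∈ Set.Icc (-2 : ℝ) 2 → s ≠ w * t},
      ∀ t ∈ Set.Icc (-2 : ℝ) 2, s - w * t ≠ 0 :=
    fun s hs t ht => sub_ne_zero.mpr (hs t ht)
  -- continuity of the integrand and of its `s`-derivative in `t`
  have hFc : ∀ s ∈ {s : ℂ | ∀ t : ℝ, t ∈ Set.Icc (-2 : ℝ) 2 → s ≠ w * t},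
      ContinuousOn (fun t : ℝ => f t * Complex.exp (w * t - s) / (s - w * t))
        (Set.Icc (-2 : ℝ) 2) := by
    intro s hs
    have h1 : Continuous fun t : ℝ => f t * Complex.exp (w * t - s) := by fun_prop
    have h2 : Continuous fun t : ℝ => s - w * t := by fun_prop
    exact h1.continuousOn.div h2.continuousOn (hne s hs)
  have hF'c : ∀ s ∈ {s : ℂ | ∀ t : ℝ, t ∈ Set.Icc (-2 : ℝ) 2 → s ≠ w * t},
      ContinuousOn (fun t : ℝ =>
        -(f t * Complex.exp (w * t - s) * (s - w * t + 1)) / (s - w * t) ^ 2)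
        (Set.Icc (-2 : ℝ) 2) := by
    intro s hs
    have h1 : Continuous fun t : ℝ => -(f t * Complex.exp (w * t - s) * (s - w * t + 1)) := by
      fun_prop
    have h2 : Continuous fun t : ℝ => (s - w * t) ^ 2 := by fun_prop
    exact h1.continuousOn.div h2.continuousOn fun t ht => pow_ne_zero 2 (hne s hs t ht)
  -- joint continuity of the derivative on the compact `closedBall s₀ r × [-2,2]`, hence a bound
  have hF'j : ContinuousOn (fun p : ℂ × ℝ =>
      -(f p.2 * Complex.exp (w * p.2 - p.1) * (p.1 - w * p.2 + 1)) / (p.1 - w * p.2) ^ 2)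
      (Metric.closedBall s₀ r ×ˢ Set.Icc (-2 : ℝ) 2) := by
    have h1 : Continuous fun p : ℂ × ℝ =>
        -(f p.2 * Complex.exp (w * p.2 - p.1) * (p.1 - w * p.2 + 1)) := by
      fun_prop
    have h2 : Continuous fun p : ℂ × ℝ => (p.1 - w * p.2) ^ 2 := by fun_prop
    refine h1.continuousOn.div h2.continuousOn ?_
    rintro ⟨s, t⟩ ⟨hs, ht⟩
    exact pow_ne_zero 2 (hne s (hcb hs) t ht)
  obtain ⟨C, hC⟩ :=
    ((isCompact_closedBall s₀ r).prod isCompact_Icc).exists_bound_of_continuousOn hF'j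
  have hIoc : Ι (-2 : ℝ) 2 ⊆ Set.Icc (-2 : ℝ) 2 := by
    rw [Set.uIoc_of_le (by norm_num)]
    exact Set.Ioc_subset_Icc_self
  have hIcc : Set.uIcc (-2 : ℝ) 2 = Set.Icc (-2 : ℝ) 2 := Set.uIcc_of_le (by norm_num)
  have key := intervalIntegral.hasDerivAt_integral_of_dominated_loc_of_deriv_le
    (μ := volume) (a := (-2 : ℝ)) (b := 2)
    (F := fun (s : ℂ) (t : ℝ) => f t * Complex.exp (w * t - s) / (s - w * t))
    (F' := fun (s : ℂ) (t : ℝ) =>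
      -(f t * Complex.exp (w * t - s) * (s - w * t + 1)) / (s - w * t) ^ 2)
    (x₀ := s₀) (bound := fun _ => C) (Metric.ball_mem_nhds s₀ hr0)
    ?meas ?int ?meas' ?bd ?bdint ?diff
  · exact key.2
  case meas =>
    filter_upwards [hUo.mem_nhds hs₀] with s hs
    exact ((hFc s hs).mono hIoc).aestronglyMeasurable measurableSet_uIoc
  case int =>
    refine ContinuousOn.intervalIntegrable ?_
    rw [hIcc]
    exact hFc s₀ hs₀
  case meas' => exact ((hF'c s₀ hs₀).mono hIoc).aestronglyMeasurable measurableSet_uIoc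
  case bd =>
    exact Eventually.of_forall fun t ht s hs =>
      hC (s, t) ⟨Metric.ball_subset_closedBall hs, hIoc ht⟩
  case bdint => exact intervalIntegrable_const
  case diff =>
    refine Eventually.of_forall fun t ht s hs => ?_
    have hst : s - w * t ≠ 0 := hne s (hball hs) t (hIoc ht)
    have h1 : HasDerivAt (fun x : ℂ => f t * Complex.exp (w * t - x))
        (f t * (Complex.exp (w * t - s) * -1)) s :=
      ((hasDerivAt_id' (x := s)).const_sub (w * t)).cexp.const_mul (f t)
    have h2 : HasDerivAt (fun x : ℂ => x - w * t) 1 s :=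
      (hasDerivAt_id' (x := s)).sub_const (w * t)
    refine (h1.div h2 hst).congr_deriv ?_
    ring

/-- **T2i `cauchyKernel_differentiableOn`** (registered stub of crux stmt-RiemannHypothesis-11229,
plan tier T2): for continuous `f : ℝ → ℂ` and `w : ℂ`, the segment Cauchy kernel
`s ↦ ∫_{-2}^{2} f t e^{wt-s}/(s-wt) dt` is holomorphic on `U_w = {s | ∀ t ∈ [-2,2], s ≠ wt}`.
[folklore] -/
theorem cauchyKernel_differentiableOn : ∀ f : ℝ → ℂ, Continuous f → ∀ w : ℂ,
    DifferentiableOn ℂ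
      (fun s : ℂ => ∫ t in (-2 : ℝ)..2, f t * Complex.exp (w * t - s) / (s - w * t))
      {s : ℂ | ∀ t : ℝ, t ∈ Set.Icc (-2 : ℝ) 2 → s ≠ w * t} :=
  fun _ hf w _ hs => (hasDerivAt_cauchyKernel hf w hs).differentiableAt.differentiableWithinAt

/-- The segment Cauchy kernel `s ↦ ∫_{-2}^{2} f t e^{wt-s}/(s-wt) dt` of a continuous `f` is
continuous on `U_w = {s | ∀ t ∈ [-2,2], s ≠ wt}` (from holomorphy). [folklore] -/
theorem continuousOn_cauchyKernel : ∀ f : ℝ → ℂ, Continuous f → ∀ w : ℂ,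
    ContinuousOn
      (fun s : ℂ => ∫ t in (-2 : ℝ)..2, f t * Complex.exp (w * t - s) / (s - w * t))
      {s : ℂ | ∀ t : ℝ, t ∈ Set.Icc (-2 : ℝ) 2 → s ≠ w * t} :=
  fun f hf w => (cauchyKernel_differentiableOn f hf w).continuousOn

end Summit.RiemannHypothesis.RiemannHypothesis.Theorems.WeilCombBohrFejer

end
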